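import Summits.CriticalPhenomena.SAWScalingLimit.Theorems.SAWDevelopingMapObservableToSLECanonicalTransferEscape
import Summits.CriticalPhenomena.SAWScalingLimit.Theorems.SAWDevelopingMapObservableToSLECanonicalTransferFamily
import HarnessLib

/-!
# Crux `SAWDefectDecoherence.ObservableToSLER` (stmt-CriticalPhenomena-14005), line
`bridge-gate-renewal` (r7), stub 5a3 `stub_twoPieceAdmIdentification`: honeycomb walks for the
admissible sub-families (column descent, walks hugging a connected set, half-ball connectivity)

Landing target:
`Summits/CriticalPhenomena/SAWScalingLimit/Theorems/SAWDefectDecoherenceObservableToSLERTwoPieceAdmIdentificationWalks.lean`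
(`--supports stmt-CriticalPhenomena-14005`).

Stub 5a3 applies the two-piece admissible restriction limit to SUB-FAMILIES `Λ' δ ⊆ Λ δ` of a
given admissible family, carved out of `Λ δ` as the lattice component of the source vertex in
the vertices of `Λ δ` at rescaled distance `> Rδ` from a compact "exclusion set" `T` (the image of
the pulled-back hull with two real whiskers).  Their admissibility (connected complement,
exact floor rows in the flat balls, exhaustion) rests on three kinds of explicit honeycomb walks,
built here from the greedy descent of crux 10472 (`FloorRatio.exists_walk_dist_smul_le`):

* `exists_walk_column` — **column descent**: a walk going straight down (lateral spread `≤ δ`,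
  heights decreasing) by any prescribed amount;
* `exists_walk_within_of_isPreconnected` — **walks hugging a preconnected set** `s ⊆ ℂ`: from a
  vertex within `r ≥ δ` of a point of `s` to within `δ` of any other point of `s`, through
  vertices ALL within `r` of `s` (sharp form of `FloorRatio.exists_walk_near_of_isPreconnected`,
  no loss in the radius: `ε`-chains via `IsPreconnected.induction₂'`);
* `exists_walk_of_pathIn` — `PathIn` chains to walks.

The sequel `…TwoPieceAdmIdentificationFlat` adds the half-ball connectivity above a flat floor.
-/

noncomputable section

open scoped Topology
open Filter Set Metric
open Literature.Probability.LatticeModels (HexVertex hexGraph hexCenter Site)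
open Literature.Probability.RandomPlanarGeometry
open Literature.Probability.RandomPlanarGeometry.SAW
open Literature.Probability.Percolation (PathIn hexCenter_re hexCenter_im)

namespace Summit.CriticalPhenomena.SAWScalingLimit.Theorems.ObservableToSLER.TwoPiece

open Summit.CriticalPhenomena.SAWScalingLimit.Theorems.ObservableToSLE.FloorRatio

/-! ### `PathIn` chains and walks -/

/-- A `PathIn` chain inside `A` is realised by a walk all of whose vertices lie in `A`. [folklore] -/
theorem exists_walk_of_pathIn {V : Type*} {G : SimpleGraph V} {A : Set V} {u v : V}
    (h : PathIn G A u v) : ∃ p : G.Walk u v, ∀ w ∈ p.support, w ∈ A := by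
  obtain ⟨hu, h⟩ := h
  induction h with
  | refl => exact ⟨SimpleGraph.Walk.nil, fun w hw => by simp_all⟩
  | @tail b c _ hbc ih =>
    obtain ⟨p, hp⟩ := ih
    refine ⟨p.append (SimpleGraph.Walk.cons hbc.1 SimpleGraph.Walk.nil), fun w hw => ?_⟩
    rw [SimpleGraph.Walk.support_append, List.mem_append] at hw
    rcases hw with hw | hw
    · exact hp w hw
    · simp only [SimpleGraph.Walk.support_cons, SimpleGraph.Walk.support_nil, List.tail_cons,
        List.mem_singleton] at hw
      exact hw ▸ hbc.2

/-! ### Coordinates -/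

/-- Real part of a rescaled face centre: `Re(δ c_{(x,k)}) = δ (x₀ + x₁/2 + (k+1)/2)`. [folklore] -/
theorem re_smul_hexCenter (δ : ℝ) (v : HexVertex) :
    ((δ : ℂ) * hexCenter v).re = δ * ((v.1 0 : ℝ) + (v.1 1 : ℝ) / 2 + ((v.2 : ℕ) + 1) / 2) := by
  obtain ⟨x, k⟩ := v
  rw [Complex.mul_re, Complex.ofReal_re, Complex.ofReal_im, zero_mul, sub_zero, hexCenter_re]

/-! ### Column descent -/

/-- **Column descent at mesh `δ`.**  From every vertex `v` and for every `L ≥ 0` there is a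
honeycomb walk going straight down: it ends at height `≤ Im(δ c_v) - L`, all its vertices have
height between `Im(δ c_v) - L - δ` and `Im(δ c_v)`, real part within `δ` of `Re(δ c_v)`, hence
are within `L + 2δ` of `δ c_v`.  (The column steps from an up-face `(x, 0)` to the down-face
`(x - e₁, 1)` vertically below it, and from a down-face `(x, 1)` down-left or down-right according
to the parity of the row, so that the lateral potential `2 Re + parity correction` is invariant
and the lateral spread is `≤ 1/2`; heights drop by `√3/6` or `√3/3` per step.) [folklore] -/
theorem exists_walk_column {δ : ℝ} (hδ : 0 < δ) (v : HexVertex) {L : ℝ} (hL : 0 ≤ L) :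
    ∃ (w : HexVertex) (p : hexGraph.Walk v w),
      ((δ : ℂ) * hexCenter w).im ≤ ((δ : ℂ) * hexCenter v).im - L ∧
      ∀ u ∈ p.support, ((δ : ℂ) * hexCenter u).im ≤ ((δ : ℂ) * hexCenter v).im ∧
        ((δ : ℂ) * hexCenter v).im - L - δ ≤ ((δ : ℂ) * hexCenter u).im ∧
        |((δ : ℂ) * hexCenter u).re - ((δ : ℂ) * hexCenter v).re| ≤ δ ∧
        dist ((δ : ℂ) * hexCenter u) ((δ : ℂ) * hexCenter v) ≤ L + 2 * δ := by
  classical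
  -- the column step and its lateral potential
  let step : HexVertex → HexVertex := fun u =>
    if u.2 = 0 then (u.1 - Pi.single 1 1, 1)
    else if Even (u.1 1) then (u.1, 0) else (u.1 + Pi.single 0 1, 0)
  let pot : HexVertex → ℤ := fun u =>
    2 * u.1 0 + u.1 1 + (u.2 : ℕ) + (if u.2 = 0 then (if Even (u.1 1) then 1 else 0)
      else (if Even (u.1 1) then 0 else 1))
  have hstep0 : ∀ x : Site 2, step (x, 0) = (x - Pi.single 1 1, 1) := fun x => by simp [step]
  have hstep1 : ∀ x : Site 2, step (x, 1) = if Even (x 1) then (x, 0) else (x + Pi.single 0 1, 0) :=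
    fun x => by simp [step]
  -- each step is an edge
  have hadj : ∀ u : HexVertex, hexGraph.Adj u (step u) := by
    rintro ⟨x, k⟩
    fin_cases k
    · rw [show ((x, (⟨0, by decide⟩ : Fin 2)) : HexVertex) = (x, 0) from rfl, hstep0]
      exact hexGraph_adj_below x
    · rw [show ((x, (⟨1, by decide⟩ : Fin 2)) : HexVertex) = (x, 1) from rfl, hstep1]
      split_ifs
      · exact ((hexGraph_adj_iff_coord x x 1 0).2 (Or.inr ⟨rfl, rfl, Or.inl ⟨rfl, rfl⟩⟩))
      · refine (hexGraph_adj_iff_coord x (x + Pi.single 0 1) 1 0).2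
          (Or.inr ⟨rfl, rfl, Or.inr (Or.inl ⟨?_, ?_⟩)⟩) <;> simp
  -- heights along a step
  have him : ∀ u : HexVertex, (hexCenter (step u)).im ≤ (hexCenter u).im - Real.sqrt 3 / 6 ∧
      (hexCenter u).im - Real.sqrt 3 / 3 ≤ (hexCenter (step u)).im := by
    have h3 : 0 < Real.sqrt 3 := by positivity
    rintro ⟨x, k⟩
    fin_cases k
    · rw [show ((x, (⟨0, by decide⟩ : Fin 2)) : HexVertex) = (x, 0) from rfl, hstep0, hexCenter_im,
        hexCenter_im]
      simp only [Pi.sub_apply, Pi.single_eq_same, Int.cast_sub, Int.cast_one, Fin.val_one,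
        Nat.cast_one, Fin.val_zero, Nat.cast_zero]
      constructor <;> nlinarith
    · rw [show ((x, (⟨1, by decide⟩ : Fin 2)) : HexVertex) = (x, 1) from rfl, hstep1]
      split_ifs
      · rw [hexCenter_im, hexCenter_im]
        simp only [Fin.val_one, Nat.cast_one, Fin.val_zero, Nat.cast_zero]
        constructor <;> nlinarith
      · rw [hexCenter_im, hexCenter_im]
        simp only [Pi.add_apply, Fin.val_one, Nat.cast_one, Fin.val_zero, Nat.cast_zero,
          Pi.single_eq_of_ne (show (1 : Fin 2) ≠ 0 by decide), add_zero]
        constructor <;> nlinarith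
  -- the potential: within `1` of `2 Re`, and invariant
  have hpot_re : ∀ u : HexVertex, |(pot u : ℝ) - 2 * (hexCenter u).re| ≤ 1 := by
    rintro ⟨x, k⟩
    simp only [pot, hexCenter_re]
    push_cast
    split_ifs <;> (try norm_num) <;> (rw [abs_le]; constructor <;> nlinarith [k.isLt])
  have hpot_step : ∀ u : HexVertex, pot (step u) = pot u := by
    rintro ⟨x, k⟩
    fin_cases k
    · rw [show ((x, (⟨0, by decide⟩ : Fin 2)) : HexVertex) = (x, 0) from rfl, hstep0]
      simp only [pot, Pi.sub_apply, Pi.single_eq_same, Fin.val_one, Nat.cast_one, one_ne_zero,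
        if_false, Fin.val_zero, Nat.cast_zero, if_true,
        Pi.single_eq_of_ne (show (0 : Fin 2) ≠ 1 by decide), sub_zero, Fin.isValue]
      rcases Int.even_or_odd (x 1) with he | ho
      · have : ¬ Even (x 1 - 1) := fun h => by
          have := Int.even_sub.1 h; simp [he] at this
        rw [if_neg this, if_pos he]; ring
      · have hne : ¬ Even (x 1) := Int.not_even_iff_odd.2 ho
        have : Even (x 1 - 1) := by
          rw [Int.even_sub]; simp [hne]
        rw [if_pos this, if_neg hne]; ring
    · rw [show ((x, (⟨1, by decide⟩ : Fin 2)) : HexVertex) = (x, 1) from rfl, hstep1]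
      split_ifs with he
      · simp [pot, he]
      · simp [pot, he]
        ring
  -- iterates: lateral spread and heights
  have hre_iter : ∀ (u : HexVertex) (n : ℕ), |(hexCenter (step^[n] u)).re - (hexCenter u).re| ≤ 1 := by
    intro u n
    have hpot : pot (step^[n] u) = pot u := by
      induction n with
      | zero => rfl
      | succ n ih => rw [Function.iterate_succ_apply', hpot_step, ih]
    have h1 := hpot_re (step^[n] u)
    have h2 := hpot_re u
    rw [hpot] at h1
    rw [abs_le] at h1 h2 ⊢
    constructor <;> linarith [h1.1, h1.2, h2.1, h2.2]
  have him_iter : ∀ (u : HexVertex) (n : ℕ),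
      (hexCenter (step^[n] u)).im ≤ (hexCenter u).im - n * (Real.sqrt 3 / 6) ∧
      ∀ k ≤ n, (hexCenter (step^[n] u)).im ≤ (hexCenter (step^[k] u)).im := by
    intro u n
    induction n with
    | zero => simp
    | succ n ih =>
      have hs := (him (step^[n] u)).1
      rw [← Function.iterate_succ_apply' step n u] at hs
      refine ⟨?_, fun k hk => ?_⟩
      · push_cast
        linarith [ih.1]
      · rcases Nat.lt_or_eq_of_le hk with hk | rfl
        · have := ih.2 k (Nat.lt_succ_iff.1 hk)
          have h3 : 0 < Real.sqrt 3 / 6 := by positivity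
          linarith
        · exact le_rfl
  have hwalk : ∀ (u : HexVertex) (n : ℕ),
      ∃ p : hexGraph.Walk u (step^[n] u), ∀ w ∈ p.support, ∃ k ≤ n, w = step^[k] u := by
    intro u n
    induction n with
    | zero => exact ⟨SimpleGraph.Walk.nil, fun w hw => ⟨0, le_rfl, by simpa using hw⟩⟩
    | succ n ih =>
      obtain ⟨p, hp⟩ := ih
      have hadj' : hexGraph.Adj (step^[n] u) (step^[n + 1] u) := by
        rw [Function.iterate_succ_apply']
        exact hadj _
      refine ⟨p.append (SimpleGraph.Walk.cons hadj' SimpleGraph.Walk.nil), fun w hw => ?_⟩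
      rw [SimpleGraph.Walk.support_append, List.mem_append] at hw
      rcases hw with hw | hw
      · obtain ⟨k, hk, rfl⟩ := hp w hw
        exact ⟨k, Nat.le_succ_of_le hk, rfl⟩
      · simp only [SimpleGraph.Walk.support_cons, SimpleGraph.Walk.support_nil, List.tail_cons,
          List.mem_singleton] at hw
        exact ⟨n + 1, le_rfl, hw⟩
  -- rescaling
  have him' : ∀ u : HexVertex, ((δ : ℂ) * hexCenter u).im = δ * (hexCenter u).im := fun u => by
    rw [Complex.mul_im, Complex.ofReal_re, Complex.ofReal_im, zero_mul, add_zero]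
  have hre' : ∀ u : HexVertex, ((δ : ℂ) * hexCenter u).re = δ * (hexCenter u).re := fun u => by
    rw [Complex.mul_re, Complex.ofReal_re, Complex.ofReal_im, zero_mul, sub_zero]
  -- the first index at which the height has dropped by `L / δ`
  have hex : ∃ n : ℕ, (hexCenter (step^[n] v)).im ≤ (hexCenter v).im - L / δ := by
    obtain ⟨n, hn⟩ := exists_nat_ge (L / δ / (Real.sqrt 3 / 6))
    refine ⟨n, (him_iter v n).1.trans ?_⟩
    have : L / δ ≤ n * (Real.sqrt 3 / 6) := (div_le_iff₀ (by positivity)).1 hn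
    linarith
  set n := Nat.find hex with hn
  have hnspec : (hexCenter (step^[n] v)).im ≤ (hexCenter v).im - L / δ := Nat.find_spec hex
  have hlow : (hexCenter v).im - L / δ - Real.sqrt 3 / 3 ≤ (hexCenter (step^[n] v)).im := by
    rcases Nat.eq_zero_or_pos n with h0 | hpos
    · rw [h0]; simp only [Function.iterate_zero, id_eq]
      have : 0 ≤ L / δ := div_nonneg hL hδ.le
      have h3 : 0 < Real.sqrt 3 := by positivity
      linarith
    · obtain ⟨m, hm⟩ : ∃ m, n = m + 1 := Nat.exists_eq_succ_of_ne_zero hpos.ne'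
      have hm' : ¬ (hexCenter (step^[m] v)).im ≤ (hexCenter v).im - L / δ :=
        Nat.find_min hex (by rw [← hn, hm]; exact Nat.lt_succ_self m)
      push Not at hm'
      have hs := (him (step^[m] v)).2
      rw [← Function.iterate_succ_apply' step m v] at hs
      rw [hm]
      change (hexCenter v).im - L / δ - Real.sqrt 3 / 3 ≤ (hexCenter (step^[m.succ] v)).im
      linarith
  have hs3 : Real.sqrt 3 ≤ 2 := by
    rw [show (2 : ℝ) = Real.sqrt 4 by
      rw [show (4 : ℝ) = 2 ^ 2 by norm_num, Real.sqrt_sq (by norm_num)]]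
    exact Real.sqrt_le_sqrt (by norm_num)
  obtain ⟨p, hp⟩ := hwalk v n
  refine ⟨step^[n] v, p, ?_, fun u hu => ?_⟩
  · rw [him', him']
    have := mul_le_mul_of_nonneg_left hnspec hδ.le
    rwa [mul_sub, mul_div_cancel₀ _ hδ.ne'] at this
  · obtain ⟨k, hk, rfl⟩ := hp u hu
    have hk1 := (him_iter v k).1
    have hk2 := (him_iter v n).2 k hk
    have hkre := hre_iter v k
    have hupper : (hexCenter (step^[k] v)).im ≤ (hexCenter v).im := by
      have : (0 : ℝ) ≤ k * (Real.sqrt 3 / 6) := by positivity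
      linarith
    have hlower : (hexCenter v).im - L / δ - 1 ≤ (hexCenter (step^[k] v)).im := by
      have : Real.sqrt 3 / 3 ≤ 1 := by linarith
      linarith
    have hI1 : ((δ : ℂ) * hexCenter (step^[k] v)).im ≤ ((δ : ℂ) * hexCenter v).im := by
      rw [him', him']; exact mul_le_mul_of_nonneg_left hupper hδ.le
    have hI2 : ((δ : ℂ) * hexCenter v).im - L - δ ≤ ((δ : ℂ) * hexCenter (step^[k] v)).im := by
      rw [him', him']
      have := mul_le_mul_of_nonneg_left hlower hδ.le
      rw [mul_sub, mul_sub, mul_div_cancel₀ _ hδ.ne', mul_one] at this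
      exact this
    have hR : |((δ : ℂ) * hexCenter (step^[k] v)).re - ((δ : ℂ) * hexCenter v).re| ≤ δ := by
      rw [hre', hre', ← mul_sub, abs_mul, abs_of_pos hδ]
      exact (mul_le_mul_of_nonneg_left hkre hδ.le).trans (le_of_eq (mul_one δ))
    refine ⟨hI1, hI2, hR, ?_⟩
    have hdist : ∀ z w : ℂ, dist z w ≤ |z.re - w.re| + |z.im - w.im| := fun z w => by
      rw [dist_eq_norm]
      have := Complex.norm_le_abs_re_add_abs_im (z - w)
      rwa [Complex.sub_re, Complex.sub_im] at this
    refine (hdist _ _).trans ?_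
    have hI : |((δ : ℂ) * hexCenter (step^[k] v)).im - ((δ : ℂ) * hexCenter v).im| ≤ L + δ := by
      rw [abs_le]; constructor <;> linarith
    linarith

/-! ### Walks hugging a preconnected set (sharp radius) -/

/-- `δ/√3 ≤ δ` for `δ ≥ 0`. [folklore] -/
theorem div_sqrt_three_le {δ : ℝ} (hδ : 0 ≤ δ) : δ / Real.sqrt 3 ≤ δ := by
  refine div_le_self hδ ?_
  rw [show (1 : ℝ) = Real.sqrt 1 by simp]
  exact Real.sqrt_le_sqrt (by norm_num)

/-- **Walks hugging a preconnected set, with no loss in the radius.**  Let `s ⊆ ℂ` be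
preconnected, `0 < δ ≤ r`, `x, y ∈ s`, and let `v` be a honeycomb vertex with
`dist (δ c_v) x ≤ r`.  Then there is a honeycomb walk from `v` to a vertex within `δ` of `y` ALL
of whose vertices are within `r` of some point of `s` (an `ε`-chain argument run through
`IsPreconnected.induction₂'`: between two `ε`-close points of `s`, greedy descent to the first and
then to the second stays within `δ/√3 + ε ≤ r` of them). [folklore] -/
theorem exists_walk_within_of_isPreconnected {s : Set ℂ} (hs : IsPreconnected s) {δ r : ℝ}
    (hδ : 0 < δ) (hδr : δ ≤ r) {x y : ℂ} (hx : x ∈ s) (hy : y ∈ s) {v : HexVertex}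
    (hv : dist ((δ : ℂ) * hexCenter v) x ≤ r) :
    ∃ (w : HexVertex) (p : hexGraph.Walk v w), dist ((δ : ℂ) * hexCenter w) y ≤ δ ∧
      ∀ u ∈ p.support, ∃ z ∈ s, dist ((δ : ℂ) * hexCenter u) z ≤ r := by
  have h3 := div_sqrt_three_le hδ.le
  have h3' : δ / Real.sqrt 3 < δ := by
    refine div_lt_self hδ ?_
    rw [show (1 : ℝ) = Real.sqrt 1 by simp]
    exact Real.sqrt_lt_sqrt (by norm_num) (by norm_num)
  -- the relation
  let P : ℂ → ℂ → Prop := fun x y => ∀ v : HexVertex, dist ((δ : ℂ) * hexCenter v) x ≤ r →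
    ∃ (w : HexVertex) (p : hexGraph.Walk v w), dist ((δ : ℂ) * hexCenter w) y ≤ δ ∧
      ∀ u ∈ p.support, ∃ z ∈ s, dist ((δ : ℂ) * hexCenter u) z ≤ r
  suffices h : P x y from h v hv
  -- one leg between two close points of `s`: greedy to the first, then greedy to the second
  have leg : ∀ x' y' : ℂ, x' ∈ s → y' ∈ s → dist x' y' < r - δ / Real.sqrt 3 → P x' y' := by
    intro x' y' hx' hy' hxy v hv
    obtain ⟨v₁, p₁, hv₁, hp₁⟩ := exists_walk_dist_smul_le hδ v x'
    obtain ⟨v₂, p₂, hv₂, hp₂⟩ := exists_walk_dist_smul_le hδ v₁ y'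
    refine ⟨v₂, p₁.append p₂, hv₂.trans h3, fun u hu => ?_⟩
    rw [SimpleGraph.Walk.support_append, List.mem_append] at hu
    rcases hu with hu | hu
    · exact ⟨x', hx', (hp₁ u hu).trans hv⟩
    · refine ⟨y', hy', (hp₂ u (List.mem_of_mem_tail hu)).trans ?_⟩
      have := dist_triangle ((δ : ℂ) * hexCenter v₁) x' y'
      linarith
  refine hs.induction₂' P (fun x hx => ?_) (fun x y z _ _ _ hxy hyz v hv => ?_) hx hy
  · have hpos : 0 < r - δ / Real.sqrt 3 := by linarith
    have hmem : s ∩ ball x (r - δ / Real.sqrt 3) ∈ 𝓝[s] x :=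
      inter_mem_nhdsWithin s (ball_mem_nhds x hpos)
    filter_upwards [hmem] with y hy
    have hxy : dist x y < r - δ / Real.sqrt 3 := by rw [dist_comm]; exact mem_ball.1 hy.2
    exact ⟨leg x y hx hy.1 hxy, leg y x hy.1 hx (by rwa [dist_comm])⟩
  · -- transitivity
    obtain ⟨w₁, p₁, hw₁, hp₁⟩ := hxy v hv
    obtain ⟨w₂, p₂, hw₂, hp₂⟩ := hyz w₁ (hw₁.trans hδr)
    refine ⟨w₂, p₁.append p₂, hw₂, fun u hu => ?_⟩
    rw [SimpleGraph.Walk.support_append, List.mem_append] at hu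
    rcases hu with hu | hu
    · exact hp₁ u hu
    · exact hp₂ u (List.mem_of_mem_tail hu)


/-! ### Registry form -/

/-- **Registered sub-goal `stub_twoPieceAdmIdentification_walks`** (crux item stmt-CriticalPhenomena-14005, line
`bridge-gate-renewal`, stub `stub_twoPieceAdmIdentification`): registry form of `exists_walk_within_of_isPreconnected` — honeycomb walks hugging a preconnected set, no loss in the radius. [folklore] -/
theorem stub_twoPieceAdmIdentification_walks :
    ∀ (S : Set ℂ) (δ r : ℝ) (x y : ℂ) (v : HexVertex), IsPreconnected S → 0 < δ → δ ≤ r →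
      x ∈ S → y ∈ S → dist ((δ : ℂ) * hexCenter v) x ≤ r →
      ∃ (w : HexVertex) (p : hexGraph.Walk v w), dist ((δ : ℂ) * hexCenter w) y ≤ δ ∧
        ∀ u ∈ p.support, ∃ z ∈ S, dist ((δ : ℂ) * hexCenter u) z ≤ r :=
  fun _ _ _ _ _ _ hS hδ hδr hx hy hv => exists_walk_within_of_isPreconnected hS hδ hδr hx hy hv

end Summit.CriticalPhenomena.SAWScalingLimit.Theorems.ObservableToSLER.TwoPiece

end
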